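import Mathlib.Tactic.Ring
import Mathlib.Tactic.NormNum
import Mathlib.Tactic.Linarith
import Mathlib.Tactic.Positivity
import Mathlib.Data.Nat.Choose.Basic
import HarnessLib

/-!
# Zero-locus Bloch seeds one and two dimensions up: the Koszul–Riemann–Roch Euler characteristics in
# relative dimension 6 and 8 (and the rank-two cross-check), in Chern roots and in Weil coordinates

Family `hodge`, layer `Literature/AlgebraicGeometry/HodgeTheory`. Fully PROVED statements (no named fact, no
definition): the kernel-checkable core of the ladder note `papers/HodgeConjecture/hodge-weil-ladder`, LADDER section
`## CARVER v7`, C47 (carver generation 7; packet `run/shared/lean/b2b/hodge-weil/`), in the standard of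
`BlochSeedRankTwoWindow.lean` (prover 2, generation 5), which treats the rank-TWO zero locus on a Weil-type abelian
FOURFOLD and finds a WINDOW (`16ω + H(m² − 4q)² ≤ 216`). The ladder's open rungs live one and two dimensions up
(Weil SIXFOLDS, codimension 3 — doors T∘S, C∘S, B′∘S of the ladder; hyperbolic EIGHTFOLDS, codimension 4 — door A∘S),
where the simplest local-complete-intersection design that can carry a Weil class is the zero scheme `Z` of a regular
section of a rank-`k` bundle `E` on an abelian `2k`-fold `Y`, `k = 3, 4`. This file records, as polynomial identities,
the Euler characteristics `χ(N_Z)`, `χ(𝒪_Z)` and the self-intersection `Z·Z` of such a design — first in CHERN ROOTS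
(universally, §1), then in the WEIL COORDINATES the doors need (§2) — and the one-line reason why the fourfold window
does not persist (§3). CENSUS ARITHMETIC for the seed hunt of Bloch's Remark (7.5) [`Bloch1972Semiregularity`]; it is
NOT a case of the Hodge conjecture and closes no rung.

## Dictionary (pen-and-paper inputs; each line is a standard theorem, named)

`Y` a complex abelian variety of dimension `2k`; `E` a vector bundle of rank `k` on `Y` with Chern roots `x₁, …, x_k`
(`c_i(E) = e_i(x)`, the elementary symmetric functions); `σ ∈ H⁰(E)` a REGULAR section with zero scheme `Z` (a local
complete intersection of codimension `k`, `dim Z = k`, `[Z] = c_k(E)`, normal bundle `N_Z = E|_Z`, `ω_Z = det E|_Z`).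
* (K) Koszul: `0 → ∧ᵏE^∨ → … → E^∨ → 𝒪_Y → 𝒪_Z → 0` is exact, so for any bundle `F`,
  `χ(F|_Z) = Σⱼ (−1)ʲ χ(F ⊗ ∧ʲE^∨)` [Fulton, Intersection Theory, §14.1; Hartshorne II.8 / III Ex. 6.x].
* (HRR) on an abelian variety `td(Y) = 1`, so `χ(G) = ∫_Y ch_{2k}(G)`, and for a (virtual) bundle with Chern roots `rₗ`
  (with signs `εₗ`), `ch_{2k} = Σₗ εₗ rₗ^{2k}/(2k)!` [Mumford, Abelian Varieties, §16; Hirzebruch]. The roots of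
  `E ⊗ ∧ʲE^∨` are `x_i − (x_{t₁} + … + x_{tⱼ})` over `i` and `j`-subsets `t`; those of `∧ʲE^∨` are `−(x_{t₁} + … + x_{tⱼ})`.
  Hence **`χ(N_Z) = (1/(2k)!) Σⱼ (−1)ʲ Σ_{|t|=j} Σ_i (x_i − Σ_{t} x)^{2k}`** and
  **`χ(𝒪_Z) = (1/(2k)!) Σⱼ (−1)ʲ Σ_{|t|=j} (Σ_t x)^{2k}`** — the left-hand sides of §1, read as Chern NUMBERS `∫_Y (…)`.
* (SD) Serre duality on the Gorenstein scheme `Z`: `hⁱ(N_Z) = h^{k−i}(E^∨ ⊗ det E|_Z) = h^{k−i}(∧^{k−1}E|_Z)`; only for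
  `k = 2` is `∧^{k−1}E = E`, giving `h²(N_Z) = h⁰(N_Z)` — the identity that closes the fourfold window
  [Hartshorne III §7].
* (B) Bloch semiregularity of `Z ⊂ Y` (codimension `k`) is injectivity of `H¹(Z, N_Z) → H^{k+1}(Y, Ω^{k−1}_Y)`, a space
  of dimension `h^{k−1,k+1}(Y) = C(2k,k−1)²` = `16, 225, 3136` for `k = 2, 3, 4` [Bloch 1972 §7; Buchweitz–Flenner
  2003 (8.1)].
* (W) Weil coordinates (an ASSUMPTION on the design — the CLASS TEST of the ladder, to be verified per candidate):
  `c_i(E) = a_i hⁱ` for `i < k` and `c_k(E) = a_k hᵏ + w` with `h` the door's rational `(1,1)`-class, `∫_Y h^{2k} = Hn`,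
  `hʲ ⌣ w = 0` (PRIM, tree `cupProduct_eq_zero_of_map_eq_smul_of_mem_weilClassesOf` and its powers) and
  `s := ∫_Y w² = (−1)ᵏ ω`, `ω > 0` for a non-zero rational Weil class (ANISO, tree
  `cupProduct_self_ne_zero_of_isRationalClass_of_mem_weilClassesOf`; the sign is Hodge–Riemann on the real primitive
  `(k,k)`-plane). Then every Chern number is `∫ c^I(E) = a^I·Hn + [I = (k,k)]·s`: the only monomial of degree `2k`
  that sees `w` is `c_k²`. Purity (`H^{2k}_Z(Y) = ℚ·[Z]` for integral `Z`) is what makes "`q·hᵏ + x` supported on `Z`"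
  the EXACT class condition `[Z] ∝ q·hᵏ + x`.

## What is proved here (arithmetic only; the dictionary is the geometry)

§1 `chiNormal_roots_two/three/four`, `chiO_roots_two/three/four`: the root sums of (HRR)+(K) equal the Chern
polynomials `(1/3)c₁²c₂ − (7/6)c₂²` ∣ `(1/2)c₃² + (1/24)c₁c₂c₃ − (1/24)c₁³c₃` ∣
`−(29/180)c₄² + (8/45)c₂²c₄ − (4/45)c₁c₃c₄ − (2/15)c₁²c₂c₄ + (1/30)c₁⁴c₄` (for `χ(N_Z)`) and
`(1/6)c₁²c₂ − (1/12)c₂²` ∣ `(1/24)(c₁c₂c₃ − c₁³c₃)` ∣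
`(1/720)c₄² + (1/360)c₂²c₄ − (1/720)c₁c₃c₄ − (1/80)c₁²c₂c₄ + (1/120)c₁⁴c₄` (for `χ(𝒪_Z)`); the `k = 2` lines are
`chiNormal_eq` of `BlochSeedRankTwoWindow.lean` re-derived from the roots. §2 `chiNormal_three_weil` etc.: in Weil
coordinates **`χ(N_Z) = Hn(a₃²/2 + a₁a₂a₃/24 − a₁³a₃/24) − ω/2`, `χ(𝒪_Z) = Hn(a₁a₂a₃ − a₁³a₃)/24` (no `ω`),
`Z·Z = a₃²Hn − ω`** at `k = 3` and **`χ(N_Z) = Hn(…) − 29ω/180`, `χ(𝒪_Z) = Hn(…) + ω/720`, `Z·Z = a₄²Hn + ω`** at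
`k = 4`. §4 (appendix, L₆): the Weil lattice of the diagonal CM sixfold `E_ι³ × E_ῑ³` with its product
principal polarization — `Hn = 720`, `Λ = ℤ·(θ³/6) ⊕ W_ℤ` (no glue), Weil charge `ω = 32d³b² + 32d²c²` (order `ℤ[√-d]`,
min `32d²`) resp. `d²((d+1)/2·b² + 2bc + 2c²)` (maximal, min `2d²`) — the inputs `Hn, ω` of §2 at door C∘S's anchor
(`weilNormSix_*`). §3 `no_window_from_euler_three`: at `k = 3` the Euler characteristic alone does not bound `h¹(N_Z)` — for
ANY value of `χ(N_Z)` and any bound there are non-negative `(h⁰, h², h³)` with `h¹ = h⁰ + h² − h³ − χ` beyond the bound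
(trivial arithmetic, recorded only to mark the contrast with `window_of_semiregular`, where (SD) removes `h²`). READING:
the Weil charge `ω` enters `χ(N_Z)` with coefficient `−7/6` against a `16`-dimensional target at `k = 2`, `−1/2` against
`225` at `k = 3`, `−29/180` against `3136` at `k = 4`; one dimension up the decision is the semiregularity map itself.
-/

namespace Literature.AlgebraicGeometry.HodgeTheory.BlochSeedZeroLocusEuler

/-! ### §1 Koszul + Hirzebruch–Riemann–Roch in Chern roots (universal polynomial identities) -/

/-- `k = 2` (rank two on an abelian FOURFOLD), `χ(N_Z)` from the roots: `(1/24)[Σ_i x_i⁴ − Σ_{i,j}(x_i − x_j)⁴ +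
Σ_i (x_i − x₁ − x₂)⁴] = (1/3)c₁²c₂ − (7/6)c₂²` with `c₁ = x + y`, `c₂ = xy` — the polynomial of `chiNormal_eq` in
`BlochSeedRankTwoWindow.lean` (`B/3 − 7C/6`), re-derived. [cite: Fulton1998, §14.1 and Example 3.2.3] [cite: MumfordAV1970, §16] -/
theorem chiNormal_roots_two (x y : ℚ) :
    (((x) ^ 4 + (y) ^ 4)
      - ((x - x) ^ 4 + (y - x) ^ 4 + (x - y) ^ 4 + (y - y) ^ 4)
      + ((x - x - y) ^ 4 + (y - x - y) ^ 4)) / 24 =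
      (1 / 3 : ℚ) * (x + y) ^ 2 * (x * y) - (7 / 6 : ℚ) * (x * y) ^ 2 := by
  ring

/-- `k = 2`, `χ(𝒪_Z) = (1/24)[−Σ_i x_i⁴ + (x₁ + x₂)⁴] = (1/6)c₁²c₂ − (1/12)c₂²` (the appendix identity
`χ(𝒪_Z) = (2m²qH − q²H − ω)/12` of `BlochSeedRankTwoWindow.lean` in Chern form). [cite: Fulton1998, §14.1] [cite: MumfordAV1970, §16] -/
theorem chiO_roots_two (x y : ℚ) :
    (-((x) ^ 4 + (y) ^ 4)
      + ((x + y) ^ 4)) / 24 =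
      (1 / 6 : ℚ) * (x + y) ^ 2 * (x * y) - (1 / 12 : ℚ) * (x * y) ^ 2 := by
  ring

/-- **`k = 3` (rank three on an abelian SIXFOLD; `Z` a threefold — the rung level of doors T∘S, C∘S, B′∘S)**:
`χ(N_Z) = (1/720) Σⱼ (−1)ʲ Σ_{|t|=j} Σ_i (x_i − Σ_t x)⁶ = (1/2)c₃² + (1/24)c₁c₂c₃ − (1/24)c₁³c₃`
with `c₁ = x + y + z`, `c₂ = xy + xz + yz`, `c₃ = xyz`. [cite: Fulton1998, §14.1 and Example 3.2.3] [cite: MumfordAV1970, §16] -/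
theorem chiNormal_roots_three (x y z : ℚ) :
    (((x) ^ 6 + (y) ^ 6 + (z) ^ 6)
      - ((x - x) ^ 6 + (y - x) ^ 6 + (z - x) ^ 6 + (x - y) ^ 6 + (y - y) ^ 6 + (z - y) ^ 6 + (x - z) ^ 6 + (y - z) ^ 6 + (z - z) ^ 6)
      + ((x - x - y) ^ 6 + (y - x - y) ^ 6 + (z - x - y) ^ 6 + (x - x - z) ^ 6 + (y - x - z) ^ 6 + (z - x - z) ^ 6 + (x - y - z) ^ 6 + (y - y - z) ^ 6 + (z - y - z) ^ 6)
      - ((x - x - y - z) ^ 6 + (y - x - y - z) ^ 6 + (z - x - y - z) ^ 6)) / 720 =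
      (1 / 2 : ℚ) * (x * y * z) ^ 2 + (1 / 24 : ℚ) * (x + y + z) * (x * y + x * z + y * z) * (x * y * z)
        - (1 / 24 : ℚ) * (x + y + z) ^ 3 * (x * y * z) := by
  ring

/-- `k = 3`, `χ(𝒪_Z) = (1/720)[−Σ_i x_i⁶ + Σ_{i<j}(x_i + x_j)⁶ − (x₁ + x₂ + x₃)⁶] = (1/24)(c₁c₂c₃ − c₁³c₃)` — NO `c₃²`
term (cross-check: `χ(𝒪_Z) = (1/24)∫_Z c₁(Z)c₂(Z)` for a threefold (`td₃ = c₁c₂/24`), with `c(T_Z) = c(E|_Z)⁻¹`,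
`c₁(Z) = −c₁`, `c₂(Z) = c₁² − c₂`).
[cite: Fulton1998, §14.1] [cite: MumfordAV1970, §16] -/
theorem chiO_roots_three (x y z : ℚ) :
    (-((x) ^ 6 + (y) ^ 6 + (z) ^ 6)
      + ((x + y) ^ 6 + (x + z) ^ 6 + (y + z) ^ 6)
      - ((x + y + z) ^ 6)) / 720 =
      (1 / 24 : ℚ) * ((x + y + z) * (x * y + x * z + y * z) * (x * y * z) - (x + y + z) ^ 3 * (x * y * z)) := by
  ring

/-- **`k = 4` (rank four on an abelian EIGHTFOLD; `Z` a fourfold — door A∘S(4,d), zero-locus format)**: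
`χ(N_Z) = (1/40320) Σⱼ (−1)ʲ Σ_{|t|=j} Σ_i (x_i − Σ_t x)⁸
 = −(29/180)c₄² + (8/45)c₂²c₄ − (4/45)c₁c₃c₄ − (2/15)c₁²c₂c₄ + (1/30)c₁⁴c₄`. [cite: Fulton1998, §14.1 and Example 3.2.3] [cite: MumfordAV1970, §16] -/
theorem chiNormal_roots_four (x y z u : ℚ) :
    (((x) ^ 8 + (y) ^ 8 + (z) ^ 8 + (u) ^ 8)
      - ((x - x) ^ 8 + (y - x) ^ 8 + (z - x) ^ 8 + (u - x) ^ 8 + (x - y) ^ 8 + (y - y) ^ 8 + (z - y) ^ 8 + (u - y) ^ 8 + (x - z) ^ 8 + (y - z) ^ 8 + (z - z) ^ 8 + (u - z) ^ 8 + (x - u) ^ 8 + (y - u) ^ 8 + (z - u) ^ 8 + (u - u) ^ 8)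
      + ((x - x - y) ^ 8 + (y - x - y) ^ 8 + (z - x - y) ^ 8 + (u - x - y) ^ 8 + (x - x - z) ^ 8 + (y - x - z) ^ 8 + (z - x - z) ^ 8 + (u - x - z) ^ 8 + (x - x - u) ^ 8 + (y - x - u) ^ 8 + (z - x - u) ^ 8 + (u - x - u) ^ 8 + (x - y - z) ^ 8 + (y - y - z) ^ 8 + (z - y - z) ^ 8 + (u - y - z) ^ 8 + (x - y - u) ^ 8 + (y - y - u) ^ 8 + (z - y - u) ^ 8 + (u - y - u) ^ 8 + (x - z - u) ^ 8 + (y - z - u) ^ 8 + (z - z - u) ^ 8 + (u - z - u) ^ 8)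
      - ((x - x - y - z) ^ 8 + (y - x - y - z) ^ 8 + (z - x - y - z) ^ 8 + (u - x - y - z) ^ 8 + (x - x - y - u) ^ 8 + (y - x - y - u) ^ 8 + (z - x - y - u) ^ 8 + (u - x - y - u) ^ 8 + (x - x - z - u) ^ 8 + (y - x - z - u) ^ 8 + (z - x - z - u) ^ 8 + (u - x - z - u) ^ 8 + (x - y - z - u) ^ 8 + (y - y - z - u) ^ 8 + (z - y - z - u) ^ 8 + (u - y - z - u) ^ 8)
      + ((x - x - y - z - u) ^ 8 + (y - x - y - z - u) ^ 8 + (z - x - y - z - u) ^ 8 + (u - x - y - z - u) ^ 8)) / 40320 =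
      -(29 / 180 : ℚ) * (x * y * z * u) ^ 2 + (8 / 45 : ℚ) * (x * y + x * z + x * u + y * z + y * u + z * u) ^ 2 * (x * y * z * u)
        - (4 / 45 : ℚ) * (x + y + z + u) * (x * y * z + x * y * u + x * z * u + y * z * u) * (x * y * z * u)
        - (2 / 15 : ℚ) * (x + y + z + u) ^ 2 * (x * y + x * z + x * u + y * z + y * u + z * u) * (x * y * z * u)
        + (1 / 30 : ℚ) * (x + y + z + u) ^ 4 * (x * y * z * u) := by
  ring

/-- `k = 4`, `χ(𝒪_Z) = (1/40320) Σⱼ (−1)ʲ Σ_{|t|=j} (Σ_t x)⁸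
 = (1/720)c₄² + (1/360)c₂²c₄ − (1/720)c₁c₃c₄ − (1/80)c₁²c₂c₄ + (1/120)c₁⁴c₄`. [cite: Fulton1998, §14.1] [cite: MumfordAV1970, §16] -/
theorem chiO_roots_four (x y z u : ℚ) :
    (-((x) ^ 8 + (y) ^ 8 + (z) ^ 8 + (u) ^ 8)
      + ((x + y) ^ 8 + (x + z) ^ 8 + (x + u) ^ 8 + (y + z) ^ 8 + (y + u) ^ 8 + (z + u) ^ 8)
      - ((x + y + z) ^ 8 + (x + y + u) ^ 8 + (x + z + u) ^ 8 + (y + z + u) ^ 8)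
      + ((x + y + z + u) ^ 8)) / 40320 =
      (1 / 720 : ℚ) * (x * y * z * u) ^ 2 + (1 / 360 : ℚ) * (x * y + x * z + x * u + y * z + y * u + z * u) ^ 2 * (x * y * z * u)
        - (1 / 720 : ℚ) * (x + y + z + u) * (x * y * z + x * y * u + x * z * u + y * z * u) * (x * y * z * u)
        - (1 / 80 : ℚ) * (x + y + z + u) ^ 2 * (x * y + x * z + x * u + y * z + y * u + z * u) * (x * y * z * u)
        + (1 / 120 : ℚ) * (x + y + z + u) ^ 4 * (x * y * z * u) := by
  ring

/-! ### §2 Weil coordinates: `∫ c^I(E) = a^I·Hn + [I = (k,k)]·s`, `s = (−1)ᵏ ω` -/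

/-- `k = 2` cross-check with `BlochSeedRankTwoWindow.chiNormal_weil`: with `∫c₁²c₂ = a₁²a₂·Hn`, `∫c₂² = a₂²·Hn + ω`
(`s = +ω` at `k = 2`), `(1/3)∫c₁²c₂ − (7/6)∫c₂² = Hn(2a₁²a₂ − 7a₂²)/6 − 7ω/6`. [cite: MumfordAV1970, §16] -/
theorem chiNormal_two_weil (Hn ω a₁ a₂ : ℚ) :
    (1 / 3 : ℚ) * (a₁ ^ 2 * a₂ * Hn) - (7 / 6 : ℚ) * (a₂ ^ 2 * Hn + ω) =
      Hn * (2 * a₁ ^ 2 * a₂ - 7 * a₂ ^ 2) / 6 - 7 * ω / 6 := by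
  ring

/-- **`k = 3`, `χ(N_Z)` in Weil coordinates**: `∫c₃² = a₃²Hn + s` with `s = −ω` (Hodge–Riemann sign `(−1)³` on the real
primitive `(3,3)` Weil plane), `∫c₁c₂c₃ = a₁a₂a₃Hn`, `∫c₁³c₃ = a₁³a₃Hn` (PRIM kills every other term):
`χ(N_Z) = Hn(a₃²/2 + a₁a₂a₃/24 − a₁³a₃/24) − ω/2`. [cite: MumfordAV1970, §16] [cite: Bloch1972Semiregularity, §7] -/
theorem chiNormal_three_weil (Hn ω a₁ a₂ a₃ : ℚ) :
    (1 / 2 : ℚ) * (a₃ ^ 2 * Hn + -ω) + (1 / 24 : ℚ) * (a₁ * a₂ * a₃ * Hn) - (1 / 24 : ℚ) * (a₁ ^ 3 * a₃ * Hn) =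
      Hn * (a₃ ^ 2 / 2 + a₁ * a₂ * a₃ / 24 - a₁ ^ 3 * a₃ / 24) - ω / 2 := by
  ring

/-- `k = 3`, `χ(𝒪_Z)` in Weil coordinates: `χ(𝒪_Z) = Hn(a₁a₂a₃ − a₁³a₃)/24` — the Weil charge does NOT enter
(no `c₃²` in the Todd-type terms). [cite: MumfordAV1970, §16] -/
theorem chiO_three_weil (Hn a₁ a₂ a₃ : ℚ) :
    (1 / 24 : ℚ) * (a₁ * a₂ * a₃ * Hn - a₁ ^ 3 * a₃ * Hn) = Hn * (a₁ * a₂ * a₃ - a₁ ^ 3 * a₃) / 24 := by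
  ring

/-- `k = 3`, self-intersection `Z·Z = ∫c₃(E)² = a₃²Hn − ω` (may be `≤ 0`). [cite: Fulton1998, §14.1] -/
theorem selfIntersection_three_weil (Hn ω a₃ : ℚ) :
    a₃ ^ 2 * Hn + -ω = a₃ ^ 2 * Hn - ω := by
  ring

/-- **`k = 4`, `χ(N_Z)` in Weil coordinates** (`s = +ω` at `k = 4`):
`χ(N_Z) = Hn(−29a₄²/180 + 8a₂²a₄/45 − 4a₁a₃a₄/45 − 2a₁²a₂a₄/15 + a₁⁴a₄/30) − 29ω/180`.
[cite: MumfordAV1970, §16] [cite: Bloch1972Semiregularity, §7] -/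
theorem chiNormal_four_weil (Hn ω a₁ a₂ a₃ a₄ : ℚ) :
    -(29 / 180 : ℚ) * (a₄ ^ 2 * Hn + ω) + (8 / 45 : ℚ) * (a₂ ^ 2 * a₄ * Hn) - (4 / 45 : ℚ) * (a₁ * a₃ * a₄ * Hn)
        - (2 / 15 : ℚ) * (a₁ ^ 2 * a₂ * a₄ * Hn) + (1 / 30 : ℚ) * (a₁ ^ 4 * a₄ * Hn) =
      Hn * (-(29 * a₄ ^ 2) / 180 + 8 * a₂ ^ 2 * a₄ / 45 - 4 * a₁ * a₃ * a₄ / 45 - 2 * a₁ ^ 2 * a₂ * a₄ / 15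
        + a₁ ^ 4 * a₄ / 30) - 29 * ω / 180 := by
  ring

/-- `k = 4`, `χ(𝒪_Z)` in Weil coordinates: `χ(𝒪_Z) = Hn(a₄²/720 + a₂²a₄/360 − a₁a₃a₄/720 − a₁²a₂a₄/80 + a₁⁴a₄/120) + ω/720`.
[cite: MumfordAV1970, §16] -/
theorem chiO_four_weil (Hn ω a₁ a₂ a₃ a₄ : ℚ) :
    (1 / 720 : ℚ) * (a₄ ^ 2 * Hn + ω) + (1 / 360 : ℚ) * (a₂ ^ 2 * a₄ * Hn) - (1 / 720 : ℚ) * (a₁ * a₃ * a₄ * Hn)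
        - (1 / 80 : ℚ) * (a₁ ^ 2 * a₂ * a₄ * Hn) + (1 / 120 : ℚ) * (a₁ ^ 4 * a₄ * Hn) =
      Hn * (a₄ ^ 2 / 720 + a₂ ^ 2 * a₄ / 360 - a₁ * a₃ * a₄ / 720 - a₁ ^ 2 * a₂ * a₄ / 80 + a₁ ^ 4 * a₄ / 120)
        + ω / 720 := by
  ring

/-- `k = 4`, self-intersection `Z·Z = ∫c₄(E)² = a₄²Hn + ω > 0` whenever `Hn > 0`, `ω > 0`. [cite: Fulton1998, §14.1] -/
theorem selfIntersection_four_weil_pos (Hn ω a₄ : ℚ) (hHn : 0 < Hn) (hω : 0 < ω) :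
    0 < a₄ ^ 2 * Hn + ω := by
  have h1 : 0 ≤ a₄ ^ 2 * Hn := by positivity
  linarith

/-! ### §3 Why the fourfold window does not persist one dimension up -/

/-- At `k = 2`, Serre duality `h²(N_Z) = h⁰(N_Z)` turns the Euler characteristic into the LOWER bound
`h¹(N_Z) = 2h⁰(N_Z) − χ(N_Z)` (`BlochSeedRankTwoWindow.hOne_lower_bound`). At `k = 3` the alternating sum has four
terms, `h¹ = h⁰ + h² − h³ − χ(N_Z)` with `h² = h¹(∧²E|_Z)`, `h³ = h⁰(∧²E|_Z)` unconstrained by the Chern data: for every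
value `χ` and every bound `B` there are non-negative `h⁰, h², h³` making `h¹` exceed `B` and others making it `0` when
`χ ≤ 0` — i.e. NO window follows from `χ(N_Z)` alone; the decision is the rank of `H¹(N_Z) → H⁴(Y, Ω²)` (`225`).
Trivial arithmetic, recorded as the contrast to `window_of_semiregular`. [cite: Bloch1972Semiregularity, Remark (7.5)]
[cite: Hartshorne1977, III §7] -/
theorem no_window_from_euler_three (χ B : ℚ) :
    (∃ h0 h2 h3 : ℚ, 0 ≤ h0 ∧ 0 ≤ h2 ∧ 0 ≤ h3 ∧ B < h0 + h2 - h3 - χ) ∧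
      (χ ≤ 0 → ∃ h0 h2 h3 : ℚ, 0 ≤ h0 ∧ 0 ≤ h2 ∧ 0 ≤ h3 ∧ h0 + h2 - h3 - χ = 0) := by
  refine ⟨⟨0, |B| + |χ| + 1, 0, le_refl 0, by positivity, le_refl 0, ?_⟩, fun hχ => ⟨0, 0, -χ, le_refl 0, le_refl 0, by linarith, by ring⟩⟩
  have hB : B ≤ |B| := le_abs_self B
  have hχ : -χ ≤ |χ| := neg_le_abs χ
  have hχ' : χ ≤ |χ| := le_abs_self χ
  linarith

/-- The three `ω`-coefficients of `χ(N_Z)` against the three Bloch target dimensions `h^{k−1,k+1} = C(2k,k−1)²`: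
`(7/6, 16)`, `(1/2, 225)`, `(29/180, 3136)`; the binomial values. [cite: Bloch1972Semiregularity, §7] -/
theorem blochTarget_dims :
    (Nat.choose 4 1) ^ 2 = 16 ∧ (Nat.choose 6 2) ^ 2 = 225 ∧ (Nat.choose 8 3) ^ 2 = 3136 ∧
      (7 / 6 : ℚ) > 1 / 2 ∧ (1 / 2 : ℚ) > 29 / 180 := by
  refine ⟨by decide, by decide, by decide, by norm_num, by norm_num⟩

/-! ### §4 The Weil lattice of the diagonal CM SIXFOLD `Y = E_ι³ × E_ῑ³` with its product principal polarization
(door C∘S's anchor, up to the isogeny pair of `HasCMBlochSeeds`): the numbers `Hn`, `ω`, and the integrality of `[Z]`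

DICTIONARY (L₆) — exact exterior-algebra computation over `ℤ` (script `weil_lattice.py` of the packet, carver g7;
validated by reproducing the fourfold Gram matrices `diag(8d², 8d)`, `[[6,3],[3,6]]`, `[[14,−7],[−7,28]]`,
`[[22,−11],[−11,66]]` of (L) in `BlochSeedRankTwoWindow.lean`): `E = ℂ/(ℤ + ℤτ)`, `τ = √-d` (order `ℤ[√-d]`) or
`τ = (1 + √-d)/2` (maximal order, `d ≡ 3 (mod 4)`), `Ψ = √-d` acting by `+Ψ` on the first three factors and `−Ψ` on the
last three (the diagonal member of the CM tensor class: `(p, q) ↦ (τ(p − q), p + q)` is a `K`-isogeny onto the tensor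
structure `(a, b) ↦ (−db, a)` on `(E³)²`); `H¹(E_t, ℤ) = ℤx_t ⊕ ℤy_t` dual to `(1, τ)`, `∫_{E_t} x_t ∧ y_t = 1`;
`θ := Σ_t u_t`, `u_t = x_t ∧ y_t = pr_t^*[pt]` (product principal polarization; `Ψ^*u_t = d·u_t`, so `θ` is
`K`-symmetric and the `K`-symmetrised class `d·ι^*a + Ψ^*ι^*a` of `HasCMBlochSeeds` is `∝ θ` for a product-type
embedding); `W ⊗ ℂ = ∧⁶V₊ ⊕ ∧⁶V₋` (tree `weilClassesOf = weilClassesPlus ⊔ weilClassesMinus`), `V₊` the `√-d`-eigenspace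
of `Ψ^*` on `H¹`, `Q₊ = ∧_{t<3}(x_t + λ₊y_t) ∧ ∧_{t≥3}(x_t + λ₋y_t) = R + √-d·I` with `R, I` rescaled to primitive integral
vectors, `W_ℚ = ℚR ⊕ ℚI`. RESULTS (every `d` listed was run; the closed forms are read off): `Hn = ∫_Y θ⁶ = 720`;
PRIM `θ ∧ R = θ ∧ I = 0`; the lattice `Λ := (ℚθ³ ⊕ W) ∩ H⁶(Y, ℤ)` SPLITS, `Λ = ℤ·(θ³/6) ⊕ W_ℤ`, `W_ℤ := W ∩ H⁶(Y, ℤ)`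
(no glue; `θ³/6 = Σ_{s<t<r} u_su_tu_r` primitive) — for `d ∈ {1, 2, 3, 5, 7}` (`ℤ[√-d]`) and `d ∈ {3, 7, 11}` (maximal);
the WEIL CHARGE `ω(w) := −∫_Y w²` (`> 0`: Hodge–Riemann sign `(−1)³`) on `W_ℤ` is the binary form
**`ω = 32d³b² + 32d²c²`** in the basis `(R, I)` for the order `ℤ[√-d]` (minimum **`32d²`**), and
**`ω = d²((d+1)/2·b² + 2bc + 2c²)`** in the basis `((R+I)/2, I)` for the maximal order, `d ≡ 3 (4)` (minimum **`2d²`**: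
`18, 98, 242` at `d = 3, 7, 11`). One dimension down the same script gives `8d²b² + 8dc²` (min `8d`) and
`d((d+1)/2·b² + 2bc + 2c²)` (min `2d`) — (L) of the fourfold file. CONSEQUENCE for a zero-locus design `[Z] = c₃(E) =
a₃θ³ + w` on this anchor: `a₃ = m/6` with `m = ∫_Z θ³/120 ∈ ℤ_{>0}`, `w ∈ W_ℤ ∖ 0`, hence (§2) `Z·Z = 20m² − ω(w)` and
`χ(N_Z) = 720(a₃²/2 + a₁a₂a₃/24 − a₁³a₃/24) − ω(w)/2` with `ω(w) ≥ 2d²` resp. `32d²`. The quantifiers of `HasCMBlochSeeds`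
range over EVERY member of the isogeny class and EVERY projective embedding; these numbers are for the diagonal member
with a product-type embedding only. -/

/-- (L₆), order `ℤ[√-d]`: the Weil charge `ω = 32d³b² + 32d²c²` of a non-zero `w = bR + cI ∈ W_ℤ` on the diagonal CM
sixfold is at least `32d²`. [cite: vanGeemen1994HodgeAV, 4.9 and 5.2] -/
theorem weilNormSix_nonmaximal_ge (d b c : ℤ) (hd : 1 ≤ d) (hbc : b ≠ 0 ∨ c ≠ 0) :
    32 * d ^ 2 ≤ 32 * d ^ 3 * b ^ 2 + 32 * d ^ 2 * c ^ 2 := by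
  have hd2 : 0 < d ^ 2 := by positivity
  rcases hbc with hb | hc
  · have hb2 : 1 ≤ b ^ 2 := by
      have := sq_pos_of_ne_zero hb
      have hb' : b ^ 2 = b * b := sq b
      nlinarith [Int.one_le_abs hb, sq_abs b]
    have hc2 : 0 ≤ c ^ 2 := sq_nonneg c
    nlinarith [mul_le_mul_of_nonneg_left hb2 hd2.le, mul_nonneg hd2.le hc2]
  · have hc2 : 1 ≤ c ^ 2 := by nlinarith [Int.one_le_abs hc, sq_abs c]
    have hb2 : 0 ≤ b ^ 2 := sq_nonneg b
    nlinarith [mul_nonneg (mul_nonneg hd2.le (by linarith : (0:ℤ) ≤ d)) hb2, mul_le_mul_of_nonneg_left hc2 hd2.le]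

/-- (L₆), `K = ℚ(√-3)`, maximal order `ℤ[ζ₃]`: `ω = 9(2b² + 2bc + 2c²) = 18b² + 18bc + 18c² ≥ 18` on `W_ℤ ∖ 0`
(minimum attained). [cite: vanGeemen1994HodgeAV, 4.9 and 5.2] [cite: Schoen1988HodgeWeil, §1] -/
theorem weilNormSix_sqrtMinus3_maximal_ge (b c : ℤ) (hbc : b ≠ 0 ∨ c ≠ 0) :
    18 ≤ 18 * b ^ 2 + 18 * b * c + 18 * c ^ 2 := by
  obtain ⟨X, hX⟩ : ∃ X : ℤ, X = b ^ 2 + b * c + c ^ 2 := ⟨_, rfl⟩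
  have h4 : 3 ≤ 4 * X := by
    rcases hbc with hb | hc
    · have hb2 : 1 ≤ b ^ 2 := by nlinarith [Int.one_le_abs hb, sq_abs b]
      nlinarith [sq_nonneg (2 * c + b)]
    · have hc2 : 1 ≤ c ^ 2 := by nlinarith [Int.one_le_abs hc, sq_abs c]
      nlinarith [sq_nonneg (2 * b + c)]
  have hX1 : 1 ≤ X := by omega
  nlinarith [hX1, hX]

/-- (L₆), `K = ℚ(√-7)`, maximal order: `ω = 49(4b² + 2bc + 2c²) = 196b² + 98bc + 98c² ≥ 98` on `W_ℤ ∖ 0`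
(minimum attained at `(b,c) = (0, ±1)`). [cite: vanGeemen1994HodgeAV, 4.9 and 5.2] -/
theorem weilNormSix_sqrtMinus7_maximal_ge (b c : ℤ) (hbc : b ≠ 0 ∨ c ≠ 0) :
    98 ≤ 196 * b ^ 2 + 98 * b * c + 98 * c ^ 2 := by
  obtain ⟨X, hX⟩ : ∃ X : ℤ, X = 2 * b ^ 2 + b * c + c ^ 2 := ⟨_, rfl⟩
  have h8 : 7 ≤ 8 * X := by
    rcases hbc with hb | hc
    · have hb2 : 1 ≤ b ^ 2 := by nlinarith [Int.one_le_abs hb, sq_abs b]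
      nlinarith [sq_nonneg (2 * c + b)]
    · have hc2 : 1 ≤ c ^ 2 := by nlinarith [Int.one_le_abs hc, sq_abs c]
      nlinarith [sq_nonneg (4 * b + c)]
  have hX1 : 1 ≤ X := by omega
  nlinarith [hX1, hX]

/-- (L₆), `K = ℚ(√-11)`, maximal order: `ω = 121(6b² + 2bc + 2c²) = 726b² + 242bc + 242c² ≥ 242` on `W_ℤ ∖ 0`.
[cite: vanGeemen1994HodgeAV, 4.9 and 5.2] -/
theorem weilNormSix_sqrtMinus11_maximal_ge (b c : ℤ) (hbc : b ≠ 0 ∨ c ≠ 0) :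
    242 ≤ 726 * b ^ 2 + 242 * b * c + 242 * c ^ 2 := by
  obtain ⟨X, hX⟩ : ∃ X : ℤ, X = 3 * b ^ 2 + b * c + c ^ 2 := ⟨_, rfl⟩
  have h12 : 11 ≤ 12 * X := by
    rcases hbc with hb | hc
    · have hb2 : 1 ≤ b ^ 2 := by nlinarith [Int.one_le_abs hb, sq_abs b]
      nlinarith [sq_nonneg (2 * c + b)]
    · have hc2 : 1 ≤ c ^ 2 := by nlinarith [Int.one_le_abs hc, sq_abs c]
      nlinarith [sq_nonneg (6 * b + c)]
  have hX1 : 1 ≤ X := by omega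
  nlinarith [hX1, hX]

/-- (L₆) + §2 bookkeeping on the diagonal CM sixfold: with `Hn = 720` and `a₃ = m/6`, `Z·Z = a₃²·720 − ω = 20m² − ω`;
for the smallest multiplicity `m = 1` the self-intersection is NEGATIVE as soon as `ω > 20`, i.e. for every `d` in the
order `ℤ[√-d]` (`ω ≥ 32`) and for the maximal orders with `d ≥ 7` (`ω ≥ 98`); only `ℚ(√-3)` (`ω = 18`) leaves
`Z·Z = 2 > 0` at `m = 1`. (A negative `Z·Z` is not an obstruction by itself; it is the first number a design must
reproduce.) [cite: Fulton1998, §14.1] -/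
theorem selfIntersection_three_productCM (m ω : ℚ) :
    (m / 6) ^ 2 * 720 - ω = 20 * m ^ 2 - ω ∧ ((20 : ℚ) * 1 ^ 2 - 18 = 2) ∧ ((20 : ℚ) * 1 ^ 2 - 32 < 0) ∧
      ((20 : ℚ) * 1 ^ 2 - 98 < 0) := by
  refine ⟨by ring, by norm_num, by norm_num, by norm_num⟩

end Literature.AlgebraicGeometry.HodgeTheory.BlochSeedZeroLocusEuler
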